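import Summits.Ventures.YMGap.FlowData.LinkCharacterBessel
import Summits.Ventures.YMGap.FlowData.LinkWeightExpansion
import Summits.Ventures.YMGap.FlowData.TorelonEnergy
import HarnessLib

/-!
# Venture YMGap, track Y3 FLOW-DATA — the electric bilinear form on functions ODD under a family of pairwise
# disjoint BLOCK FLIPS of `SU(2)` links: `|∫∫ ψ W h| ≤ q₁(β)^{#blocks} q₀(β)^{N−#blocks} ‖ψ‖₂ ‖h‖₂` (theorems only;
# index-generic file 4/4 of the `SU2Links` chain)

HONEST FRAMING: venture file of the cell `pub-ymgap` (QuantumFields programme), track Y3; the analytic core of the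
STRONG-COUPLING WINDOW for the typed torelon / flux energies on cubic tubes `(ℤ/L)^k`
(`FlowData/TubeStrongCouplingWindow.lean`) AND on rectangular tubes `Π_i ℤ/(Ls i)` — written ONCE for an arbitrary
finite index type `ι` of links (measure `Measure.pi fun _ : ι => haarProbability SU(2)`, which is the tree's
`sliceMeasure` for `ι = Edge k L` and `rectSliceMeasure` for `ι = RectTorusSite Ls × Fin k`, both by `rfl`) and an
arbitrary family of BLOCKS `blk : S → ι → Prop` (decidable, pairwise disjoint; on a tube: the hyperplanes
`{(x, μ) : x_μ = s}` of the flux directions).  Finite Haar integrals over `SU(2)^ι`; no number, no row, nothing about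
limits or a mass gap.  NO Peter–Weyl (Bessel's inequality of `LinkCharacterBessel` replaces completeness).

Notation of the docstrings (spelled out in the statements): `c_n(β) = I_n(β) − I_{n+2}(β)`, `q_n = c_n/(n+1)`,
`W(a,b) = ∏_e e^{β a₀(b_e a_e⁻¹)}`, `X_ν`, `d_ν`, `p_ν` as in `LinkCharacterMerging`; the BLOCK FLIP `σ_B` of a set
of links `B` multiplies every link of `B` by the centre element `−1`.

* `chebyshevU_su2a0_su2MinusOne_mul` — `χ_n(−X) = (−1)^n χ_n(X)`;
* `prod_su2Character_blockFlip` — `X_ν(a, σ_B b) = (−1)^{Σ_{e ∈ B} ν_e} X_ν(a, b)`; `measurePreserving_blockFlip`;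
* `integral_prod_su2Character_mul_eq_zero_of_odd` — if `h ∘ σ_B = −h` a.e. and `Σ_{e∈B} ν_e` is even then
  `p_ν h = 0` identically;
* **`prod_div_succ_le_of_forall_odd_blocks`** — THE COMBINATORIAL HEART: if `Σ_{e ∈ B_s} ν_e` is odd for EVERY block
  `B_s`, `s ∈ S`, of a pairwise disjoint family, then `∏_e q_{ν_e} ≤ q₁^{#S} q₀^{N−#S}` (`N = #ι`): each block carries
  a link with `ν_e ≥ 1`, and `q_n` is antitone in `n` (`besselISub_div_succ_antitone`);
* **`abs_integral_mul_integral_weight_mul_le_of_odd_blocks`** — THE ODD-SECTOR BOUND: for square-integrable `ψ, h`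
  with `h ∘ σ_{B_s} = −h` a.e. for every `s`, `|∫ ψ(a) ∫ W(a,b) h(b) db da| ≤ q₁^{#S} q₀^{N−#S} (∫ψ²)^{1/2} (∫h²)^{1/2}`.

References: G. 't Hooft, Nucl. Phys. B 153 (1979) 141 [cite: tHooft1979Flux]; I. Montvay, G. Münster (1994)
§3.2.6, §3.4.2 [cite: MontvayMunster1994, §3.4.2]; DLMF §10.37 (monotonicity of `I_ν` in the order).
-/

noncomputable section

open scoped BigOperators Topology
open MeasureTheory Filter Function Set Polynomial.Chebyshev
open Literature.MathematicalPhysics.QuantumFieldTheory Literature.MathematicalPhysics.QuantumLattice Literature.Analysis.FunctionSpaces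
open Literature.Analysis.OperatorTheory
open Summit.Ventures.LatticeQCDFlow.Exactness Summit.Ventures.LatticeQCDFlow.Scoring

namespace Summit.Ventures.YMGap.FlowData.SU2Links

/-! ### Parity of the product characters under a block flip -/

section Parity

variable {ι : Type*} [Fintype ι]

/-- **Parity of the `SU(2)` characters under the centre**: `χ_n(−X) = (−1)^n χ_n(X)`. [folklore] -/
theorem chebyshevU_su2a0_su2MinusOne_mul (n : ℕ) (X : Matrix.specialUnitaryGroup (Fin 2) ℂ) :
    (U ℝ n).eval (su2a0 (su2MinusOne * X)) = (-1 : ℝ) ^ n * (U ℝ n).eval (su2a0 X) := by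
  have h1 : su2a0 (su2MinusOne * X) = -su2a0 X := by
    unfold su2a0
    rw [Submonoid.coe_mul, coe_su2MinusOne, neg_one_mul, Matrix.trace_neg, Complex.neg_re, neg_div]
  rw [h1, U_eval_neg]
  norm_cast

/-- **The product character under a block flip** `σ_B` (every link of the block `B = {e : p e}` multiplied by
`−1`): `X_ν(a, σ_B b) = (−1)^{Σ_{e ∈ B} ν_e} X_ν(a, b)`. [cite: tHooft1979Flux] -/
theorem prod_su2Character_blockFlip (p : ι → Prop) [DecidablePred p] (ν : ι → ℕ)
    (a b : ι → Matrix.specialUnitaryGroup (Fin 2) ℂ) :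
    ∏ e, (U ℝ (ν e)).eval (su2a0 (((if p e then su2MinusOne else 1) * b e) * (a e)⁻¹)) =
      (-1 : ℝ) ^ (∑ e ∈ Finset.univ.filter p, ν e) * ∏ e, (U ℝ (ν e)).eval (su2a0 (b e * (a e)⁻¹)) := by
  have h1 : ∀ e : ι,
      (U ℝ (ν e)).eval (su2a0 (((if p e then su2MinusOne else 1) * b e) * (a e)⁻¹)) =
        (if p e then (-1 : ℝ) ^ (ν e) else 1) * (U ℝ (ν e)).eval (su2a0 (b e * (a e)⁻¹)) := by
    intro e
    split_ifs with he
    · rw [mul_assoc, chebyshevU_su2a0_su2MinusOne_mul]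
    · rw [one_mul, one_mul]
  simp_rw [h1]
  rw [Finset.prod_mul_distrib, Finset.prod_ite, Finset.prod_const_one, mul_one, Finset.prod_pow_eq_pow_sum]

/-- A block flip preserves the product Haar measure (left translation, link by link). [folklore] -/
theorem measurePreserving_blockFlip (p : ι → Prop) [DecidablePred p] :
    MeasurePreserving (fun (b : ι → Matrix.specialUnitaryGroup (Fin 2) ℂ) (e : ι) =>
        (if p e then su2MinusOne else 1) * b e)
      (Measure.pi fun _ : ι => haarProbability (Matrix.specialUnitaryGroup (Fin 2) ℂ))
      (Measure.pi fun _ : ι => haarProbability (Matrix.specialUnitaryGroup (Fin 2) ℂ)) :=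
  measurePreserving_pi (f := fun (e : ι) (x : Matrix.specialUnitaryGroup (Fin 2) ℂ) =>
      (if p e then su2MinusOne else 1) * x)
    (fun _ : ι => haarProbability (Matrix.specialUnitaryGroup (Fin 2) ℂ))
    (fun _ : ι => haarProbability (Matrix.specialUnitaryGroup (Fin 2) ℂ))
    fun _ => measurePreserving_mul_left (haarProbability (Matrix.specialUnitaryGroup (Fin 2) ℂ)) _

/-- **Even blocks are invisible to odd functions**: if `h ∘ σ_B = −h` a.e. and `Σ_{e ∈ B} ν_e` is even, then
`∫ X_ν(a, b) h(b) db = 0` for every `a`. [folklore] -/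
theorem integral_prod_su2Character_mul_eq_zero_of_odd (p : ι → Prop) [DecidablePred p] (ν : ι → ℕ)
    {h : (ι → Matrix.specialUnitaryGroup (Fin 2) ℂ) → ℝ}
    (hodd : ∀ᵐ b ∂(Measure.pi fun _ : ι => haarProbability (Matrix.specialUnitaryGroup (Fin 2) ℂ)),
      h (fun e => (if p e then su2MinusOne else 1) * b e) = -h b)
    (heven : Even (∑ e ∈ Finset.univ.filter p, ν e))
    (a : ι → Matrix.specialUnitaryGroup (Fin 2) ℂ) :
    ∫ b, (∏ e, (U ℝ (ν e)).eval (su2a0 (b e * (a e)⁻¹))) * h b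
      ∂(Measure.pi fun _ : ι => haarProbability (Matrix.specialUnitaryGroup (Fin 2) ℂ)) = 0 := by
  set m : Measure (ι → Matrix.specialUnitaryGroup (Fin 2) ℂ) :=
    Measure.pi fun _ : ι => haarProbability (Matrix.specialUnitaryGroup (Fin 2) ℂ) with hm
  set σ : (ι → Matrix.specialUnitaryGroup (Fin 2) ℂ) → (ι → Matrix.specialUnitaryGroup (Fin 2) ℂ) :=
    fun b e => (if p e then su2MinusOne else 1) * b e with hσ
  have hmp : MeasurePreserving σ m m := measurePreserving_blockFlip p
  have hemb : MeasurableEmbedding σ :=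
    (MeasurableEquiv.piCongrRight fun e : ι =>
      MeasurableEquiv.mulLeft (if p e then su2MinusOne else (1 : Matrix.specialUnitaryGroup (Fin 2) ℂ))).measurableEmbedding
  set I : ℝ := ∫ b, (∏ e, (U ℝ (ν e)).eval (su2a0 (b e * (a e)⁻¹))) * h b ∂m with hI
  have hflip : I = ∫ b, (∏ e, (U ℝ (ν e)).eval (su2a0 (σ b e * (a e)⁻¹))) * h (σ b) ∂m := by
    rw [hI, ← hmp.integral_comp hemb]
  have hsign : (-1 : ℝ) ^ (∑ e ∈ Finset.univ.filter p, ν e) = 1 := heven.neg_one_pow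
  have h2 : ∫ b, (∏ e, (U ℝ (ν e)).eval (su2a0 (σ b e * (a e)⁻¹))) * h (σ b) ∂m = -I := by
    rw [hI, ← integral_neg]
    refine integral_congr_ae ?_
    filter_upwards [hodd] with b hb
    have hX : ∏ e, (U ℝ (ν e)).eval (su2a0 (σ b e * (a e)⁻¹)) = ∏ e, (U ℝ (ν e)).eval (su2a0 (b e * (a e)⁻¹)) := by
      have h := prod_su2Character_blockFlip p ν a b
      rw [hsign, one_mul] at h
      exact h
    rw [hX]
    change (∏ e, (U ℝ (ν e)).eval (su2a0 (b e * (a e)⁻¹))) * h (σ b) = -((∏ e, (U ℝ (ν e)).eval (su2a0 (b e * (a e)⁻¹))) * h b)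
    rw [show h (σ b) = -h b from hb]
    ring
  have h3 : I = -I := hflip.trans h2
  linarith

end Parity

/-! ### The combinatorial heart: a jointly odd multi-index pays `q₁/q₀` once per block -/

section Coefficients

variable {ι : Type*} [Fintype ι] {S : Type*} [Fintype S]

/-- An odd sum over a finite set has an odd term. [folklore] -/
theorem exists_odd_of_odd_sum {α : Type*} {s : Finset α} {f : α → ℕ} (h : Odd (∑ i ∈ s, f i)) :
    ∃ i ∈ s, Odd (f i) := by
  by_contra hne
  push Not at hne
  have heven : Even (∑ i ∈ s, f i) := Finset.even_sum _ fun i hi => Nat.not_odd_iff_even.1 (hne i hi)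
  exact (Nat.not_even_iff_odd.2 h) heven

/-- **THE COMBINATORIAL HEART.**  If every block `B_s = {e : blk s e}`, `s ∈ S`, of a pairwise disjoint family of
blocks carries an odd total index `Σ_{e ∈ B_s} ν_e`, then `∏_e q_{ν_e}(β) ≤ q₁(β)^{#S} · q₀(β)^{N−#S}` (`β > 0`,
`N = #ι`): choose in each of the `#S` disjoint blocks a link with `ν_e ≥ 1`; there `q_{ν_e} ≤ q₁`, everywhere else
`q_{ν_e} ≤ q₀` (`q_n` antitone in `n`, non-negative). [cite: MontvayMunster1994, §3.2.6] -/
theorem prod_div_succ_le_of_forall_odd_blocks {β : ℝ} (hβ : 0 < β) (blk : S → ι → Prop)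
    [∀ s, DecidablePred (blk s)] (hdisj : ∀ s t e, blk s e → blk t e → s = t) (ν : ι → ℕ)
    (hodd : ∀ s : S, Odd (∑ e ∈ Finset.univ.filter (blk s), ν e)) :
    ∏ e, (besselI (ν e) β - besselI (ν e + 2) β) / ((ν e : ℝ) + 1) ≤
      ((besselI 1 β - besselI 3 β) / 2) ^ Fintype.card S *
        ((besselI 0 β - besselI 2 β) / 1) ^ (Fintype.card ι - Fintype.card S) := by
  classical
  -- one marked link per block
  have hpick : ∀ s : S, ∃ e : ι, blk s e ∧ 1 ≤ ν e := by
    intro s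
    obtain ⟨e, he, ho⟩ := exists_odd_of_odd_sum (hodd s)
    refine ⟨e, (Finset.mem_filter.1 he).2, ?_⟩
    exact Nat.one_le_iff_ne_zero.2 fun h0 => by rw [h0] at ho; exact (Nat.not_odd_iff_even.2 (by decide)) ho
  choose pick hpick_mem hpick_ge using hpick
  have hinj : Injective pick := fun s t hst =>
    hdisj s t (pick t) (hst ▸ hpick_mem s) (hpick_mem t)
  set E : Finset ι := Finset.univ.image pick with hE
  have hcard : E.card = Fintype.card S := by
    rw [hE, Finset.card_image_of_injective _ hinj, Finset.card_univ]
  -- the pointwise bounds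
  set q : ℕ → ℝ := fun n => (besselI n β - besselI (n + 2) β) / ((n : ℝ) + 1) with hq
  have hq0 : ∀ n, 0 ≤ q n := fun n => div_nonneg (besselISub_nonneg hβ.le n) (by positivity)
  have hanti : Antitone q := besselISub_div_succ_antitone hβ
  have hle : ∀ e : ι, q (ν e) ≤ if e ∈ E then q 1 else q 0 := by
    intro e
    split_ifs with he
    · obtain ⟨s, _, rfl⟩ := Finset.mem_image.1 he
      exact hanti (hpick_ge s)
    · exact hanti (Nat.zero_le _)
  have h1 : ∏ e, q (ν e) ≤ ∏ e : ι, (if e ∈ E then q 1 else q 0) :=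
    Finset.prod_le_prod (fun e _ => hq0 _) fun e _ => hle e
  have h2 : ∏ e : ι, (if e ∈ E then q 1 else q 0) =
      q 1 ^ Fintype.card S * q 0 ^ (Fintype.card ι - Fintype.card S) := by
    rw [Finset.prod_ite, Finset.prod_const, Finset.prod_const]
    have hc1 : (Finset.univ.filter fun e : ι => e ∈ E).card = Fintype.card S := by
      rw [Finset.filter_mem_eq_inter, Finset.univ_inter, hcard]
    have hc2 : (Finset.univ.filter fun e : ι => ¬e ∈ E).card = Fintype.card ι - Fintype.card S := by
      rw [Finset.filter_not, Finset.filter_mem_eq_inter, Finset.univ_inter, Finset.card_univ_sdiff, hcard]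
    rw [hc1, hc2]
  have h3 : q 1 = (besselI 1 β - besselI 3 β) / 2 := by
    simp only [hq]; norm_num
  have h4 : q 0 = (besselI 0 β - besselI 2 β) / 1 := by
    simp only [hq]; norm_num
  calc ∏ e, (besselI (ν e) β - besselI (ν e + 2) β) / ((ν e : ℝ) + 1) = ∏ e, q (ν e) := rfl
    _ ≤ ∏ e : ι, (if e ∈ E then q 1 else q 0) := h1
    _ = q 1 ^ Fintype.card S * q 0 ^ (Fintype.card ι - Fintype.card S) := h2
    _ = ((besselI 1 β - besselI 3 β) / 2) ^ Fintype.card S *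
          ((besselI 0 β - besselI 2 β) / 1) ^ (Fintype.card ι - Fintype.card S) := by rw [h3, h4]

/-- `0 ≤ q₁^M q₀^{N−M}`. [folklore] -/
theorem oddBlocksBound_nonneg {β : ℝ} (hβ : 0 ≤ β) (M N : ℕ) :
    0 ≤ ((besselI 1 β - besselI 3 β) / 2) ^ M * ((besselI 0 β - besselI 2 β) / 1) ^ (N - M) :=
  mul_nonneg (pow_nonneg (div_nonneg (besselISub_nonneg hβ 1) zero_le_two) _)
    (pow_nonneg (div_nonneg (besselISub_nonneg hβ 0) zero_le_one) _)

end Coefficients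

/-! ### The odd-sector bound for the electric bilinear form -/

section OddSector

variable {ι : Type*} [Fintype ι] {S : Type*} [Fintype S]

/-- **Termwise bound**: for `h` odd under every block flip of the family, every term of the bilinear series obeys
`|q_ν ∫ ψ · p_ν h| ≤ q₁^{#S} q₀^{N−#S} · (∫(p_ν ψ)²)^{1/2} (∫(p_ν h)²)^{1/2}` (an even block: the term vanishes;
otherwise the coefficient bound and Cauchy–Schwarz). [folklore] -/
theorem abs_coeff_mul_integral_le_of_odd_blocks {β : ℝ} (hβ : 0 < β) (blk : S → ι → Prop)
    [∀ s, DecidablePred (blk s)] (hdisj : ∀ s t e, blk s e → blk t e → s = t) (ν : ι → ℕ)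
    {ψ h : (ι → Matrix.specialUnitaryGroup (Fin 2) ℂ) → ℝ}
    (hψ : Integrable ψ (Measure.pi fun _ : ι => haarProbability (Matrix.specialUnitaryGroup (Fin 2) ℂ)))
    (hh : Integrable h (Measure.pi fun _ : ι => haarProbability (Matrix.specialUnitaryGroup (Fin 2) ℂ)))
    (hodd : ∀ s : S, ∀ᵐ b ∂(Measure.pi fun _ : ι => haarProbability (Matrix.specialUnitaryGroup (Fin 2) ℂ)),
      h (fun e => (if blk s e then su2MinusOne else 1) * b e) = -h b) :
    |(∏ e, (besselI (ν e) β - besselI (ν e + 2) β) / ((ν e : ℝ) + 1)) *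
        ∫ a, ψ a * ((∏ e, ((ν e : ℝ) + 1)) * ∫ b, (∏ e, (U ℝ (ν e)).eval (su2a0 (b e * (a e)⁻¹))) * h b
          ∂(Measure.pi fun _ : ι => haarProbability (Matrix.specialUnitaryGroup (Fin 2) ℂ)))
          ∂(Measure.pi fun _ : ι => haarProbability (Matrix.specialUnitaryGroup (Fin 2) ℂ))| ≤
      (((besselI 1 β - besselI 3 β) / 2) ^ Fintype.card S *
          ((besselI 0 β - besselI 2 β) / 1) ^ (Fintype.card ι - Fintype.card S)) *
        (Real.sqrt (∫ a, ((∏ e, ((ν e : ℝ) + 1)) * ∫ b, (∏ e, (U ℝ (ν e)).eval (su2a0 (b e * (a e)⁻¹))) * ψ b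
            ∂(Measure.pi fun _ : ι => haarProbability (Matrix.specialUnitaryGroup (Fin 2) ℂ))) ^ 2
            ∂(Measure.pi fun _ : ι => haarProbability (Matrix.specialUnitaryGroup (Fin 2) ℂ))) *
          Real.sqrt (∫ a, ((∏ e, ((ν e : ℝ) + 1)) * ∫ b, (∏ e, (U ℝ (ν e)).eval (su2a0 (b e * (a e)⁻¹))) * h b
            ∂(Measure.pi fun _ : ι => haarProbability (Matrix.specialUnitaryGroup (Fin 2) ℂ))) ^ 2
            ∂(Measure.pi fun _ : ι => haarProbability (Matrix.specialUnitaryGroup (Fin 2) ℂ)))) := by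
  set B : ℝ := ((besselI 1 β - besselI 3 β) / 2) ^ Fintype.card S *
    ((besselI 0 β - besselI 2 β) / 1) ^ (Fintype.card ι - Fintype.card S) with hB
  have hB0 : 0 ≤ B := oddBlocksBound_nonneg hβ.le _ _
  by_cases hall : ∀ s : S, Odd (∑ e ∈ Finset.univ.filter (blk s), ν e)
  · -- surviving block pattern: coefficient ≤ B, integral by Cauchy–Schwarz
    have ht : (∏ e, (besselI (ν e) β - besselI (ν e + 2) β) / ((ν e : ℝ) + 1)) ≤ B :=
      prod_div_succ_le_of_forall_odd_blocks hβ blk hdisj ν hall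
    rw [abs_mul, abs_of_nonneg (prod_div_succ_nonneg hβ.le ν)]
    exact mul_le_mul ht (abs_integral_mul_charProj_le ν hψ hh) (abs_nonneg _) hB0
  · -- an even block: `p_ν h = 0`, the term vanishes
    push Not at hall
    obtain ⟨s, hs⟩ := hall
    have heven : Even (∑ e ∈ Finset.univ.filter (blk s), ν e) := Nat.not_odd_iff_even.1 hs
    have hzero : ∀ a : ι → Matrix.specialUnitaryGroup (Fin 2) ℂ,
        ∫ b, (∏ e, (U ℝ (ν e)).eval (su2a0 (b e * (a e)⁻¹))) * h b
          ∂(Measure.pi fun _ : ι => haarProbability (Matrix.specialUnitaryGroup (Fin 2) ℂ)) = 0 := fun a =>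
      integral_prod_su2Character_mul_eq_zero_of_odd (blk s) ν (hodd s) heven a
    simp_rw [hzero, mul_zero, integral_zero, mul_zero, abs_zero]
    positivity

/-- **THE ODD-SECTOR BOUND.**  On `SU(2)^ι` (`N = #ι` links), for `β > 0`, a pairwise disjoint decidable family of
blocks `B_s`, `s ∈ S`, and square-integrable `ψ, h` with `h ∘ σ_{B_s} = −h` a.e. for every `s`:
`|∫ ψ(a) (∫ ∏_e e^{β a₀(b_e a_e⁻¹)} h(b) db) da| ≤ q₁(β)^{#S} q₀(β)^{N−#S} (∫ψ²)^{1/2} (∫h²)^{1/2}`,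
`q₀ = c₀ = I₀ − I₂`, `q₁ = c₁/2 = (I₁ − I₃)/2`.  (Series of `LinkWeightExpansion`; termwise bound; Cauchy–Schwarz on
finite partial sums; Bessel's inequality of `LinkCharacterBessel`; no completeness.) [cite: MontvayMunster1994, §3.2.6] -/
theorem abs_integral_mul_integral_weight_mul_le_of_odd_blocks {β : ℝ} (hβ : 0 < β) (blk : S → ι → Prop)
    [∀ s, DecidablePred (blk s)] (hdisj : ∀ s t e, blk s e → blk t e → s = t)
    {ψ h : (ι → Matrix.specialUnitaryGroup (Fin 2) ℂ) → ℝ}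
    (hψ : MemLp ψ 2 (Measure.pi fun _ : ι => haarProbability (Matrix.specialUnitaryGroup (Fin 2) ℂ)))
    (hh : MemLp h 2 (Measure.pi fun _ : ι => haarProbability (Matrix.specialUnitaryGroup (Fin 2) ℂ)))
    (hodd : ∀ s : S, ∀ᵐ b ∂(Measure.pi fun _ : ι => haarProbability (Matrix.specialUnitaryGroup (Fin 2) ℂ)),
      h (fun e => (if blk s e then su2MinusOne else 1) * b e) = -h b) :
    |∫ a, ψ a * ∫ b, (∏ e, Real.exp (β * su2a0 (b e * (a e)⁻¹))) * h b
        ∂(Measure.pi fun _ : ι => haarProbability (Matrix.specialUnitaryGroup (Fin 2) ℂ))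
        ∂(Measure.pi fun _ : ι => haarProbability (Matrix.specialUnitaryGroup (Fin 2) ℂ))| ≤
      (((besselI 1 β - besselI 3 β) / 2) ^ Fintype.card S *
          ((besselI 0 β - besselI 2 β) / 1) ^ (Fintype.card ι - Fintype.card S)) *
        (Real.sqrt (∫ a, ψ a ^ 2 ∂(Measure.pi fun _ : ι => haarProbability (Matrix.specialUnitaryGroup (Fin 2) ℂ))) *
          Real.sqrt (∫ a, h a ^ 2 ∂(Measure.pi fun _ : ι => haarProbability (Matrix.specialUnitaryGroup (Fin 2) ℂ)))) := by
  set m : Measure (ι → Matrix.specialUnitaryGroup (Fin 2) ℂ) :=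
    Measure.pi fun _ : ι => haarProbability (Matrix.specialUnitaryGroup (Fin 2) ℂ) with hm
  have hψi : Integrable ψ m := hψ.integrable one_le_two
  have hhi : Integrable h m := hh.integrable one_le_two
  set B : ℝ := ((besselI 1 β - besselI 3 β) / 2) ^ Fintype.card S *
    ((besselI 0 β - besselI 2 β) / 1) ^ (Fintype.card ι - Fintype.card S) with hB
  have hB0 : 0 ≤ B := oddBlocksBound_nonneg hβ.le _ _
  -- the series and its terms
  set t : (ι → ℕ) → ℝ := fun ν => ∏ e, (besselI (ν e) β - besselI (ν e + 2) β) / ((ν e : ℝ) + 1) with ht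
  set pψ : (ι → ℕ) → (ι → Matrix.specialUnitaryGroup (Fin 2) ℂ) → ℝ := fun ν a =>
    (∏ e, ((ν e : ℝ) + 1)) * ∫ b, (∏ e, (U ℝ (ν e)).eval (su2a0 (b e * (a e)⁻¹))) * ψ b ∂m with hpψ
  set ph : (ι → ℕ) → (ι → Matrix.specialUnitaryGroup (Fin 2) ℂ) → ℝ := fun ν a =>
    (∏ e, ((ν e : ℝ) + 1)) * ∫ b, (∏ e, (U ℝ (ν e)).eval (su2a0 (b e * (a e)⁻¹))) * h b ∂m with hph
  set I : (ι → ℕ) → ℝ := fun ν => ∫ a, ψ a * ph ν a ∂m with hI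
  set x : (ι → ℕ) → ℝ := fun ν => Real.sqrt (∫ a, (pψ ν a) ^ 2 ∂m) with hx
  set y : (ι → ℕ) → ℝ := fun ν => Real.sqrt (∫ a, (ph ν a) ^ 2 ∂m) with hy
  have hseries : ∫ a, ψ a * ∫ b, (∏ e, Real.exp (β * su2a0 (b e * (a e)⁻¹))) * h b ∂m ∂m = ∑' ν, t ν * I ν :=
    integral_mul_integral_weight_mul_eq_tsum hβ.le hψi hhi
  have hsum : Summable fun ν => |t ν * I ν| := summable_abs_coeff_mul_integral_mul_charProj hβ.le hψi hhi
  have hterm : ∀ ν, |t ν * I ν| ≤ B * (x ν * y ν) := fun ν =>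
    abs_coeff_mul_integral_le_of_odd_blocks hβ blk hdisj ν hψi hhi hodd
  -- finite partial sums: Cauchy–Schwarz and Bessel
  have hx2 : ∀ ν, x ν ^ 2 = ∫ a, (pψ ν a) ^ 2 ∂m := fun ν => Real.sq_sqrt (integral_nonneg fun a => sq_nonneg _)
  have hy2 : ∀ ν, y ν ^ 2 = ∫ a, (ph ν a) ^ 2 ∂m := fun ν => Real.sq_sqrt (integral_nonneg fun a => sq_nonneg _)
  have hfin : ∀ F : Finset (ι → ℕ), ∑ ν ∈ F, |t ν * I ν| ≤
      B * (Real.sqrt (∫ a, ψ a ^ 2 ∂m) * Real.sqrt (∫ a, h a ^ 2 ∂m)) := by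
    intro F
    have h1 : ∑ ν ∈ F, |t ν * I ν| ≤ B * ∑ ν ∈ F, x ν * y ν := by
      rw [Finset.mul_sum]
      exact Finset.sum_le_sum fun ν _ => hterm ν
    have hcs : ∑ ν ∈ F, x ν * y ν ≤ Real.sqrt (∑ ν ∈ F, x ν ^ 2) * Real.sqrt (∑ ν ∈ F, y ν ^ 2) := by
      rw [← Real.sqrt_mul (Finset.sum_nonneg fun ν _ => sq_nonneg _)]
      exact (le_abs_self _).trans (Real.abs_le_sqrt (Finset.sum_mul_sq_le_sq_mul_sq F x y))
    have hbx : Real.sqrt (∑ ν ∈ F, x ν ^ 2) ≤ Real.sqrt (∫ a, ψ a ^ 2 ∂m) := by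
      refine Real.sqrt_le_sqrt ?_
      simp_rw [hx2]
      exact sum_integral_charProj_sq_le F hψ
    have hby : Real.sqrt (∑ ν ∈ F, y ν ^ 2) ≤ Real.sqrt (∫ a, h a ^ 2 ∂m) := by
      refine Real.sqrt_le_sqrt ?_
      simp_rw [hy2]
      exact sum_integral_charProj_sq_le F hh
    calc ∑ ν ∈ F, |t ν * I ν| ≤ B * ∑ ν ∈ F, x ν * y ν := h1
      _ ≤ B * (Real.sqrt (∑ ν ∈ F, x ν ^ 2) * Real.sqrt (∑ ν ∈ F, y ν ^ 2)) := mul_le_mul_of_nonneg_left hcs hB0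
      _ ≤ B * (Real.sqrt (∫ a, ψ a ^ 2 ∂m) * Real.sqrt (∫ a, h a ^ 2 ∂m)) :=
          mul_le_mul_of_nonneg_left (mul_le_mul hbx hby (Real.sqrt_nonneg _) (Real.sqrt_nonneg _)) hB0
  -- pass to the series
  have htsum : ∑' ν, |t ν * I ν| ≤ B * (Real.sqrt (∫ a, ψ a ^ 2 ∂m) * Real.sqrt (∫ a, h a ^ 2 ∂m)) :=
    Real.tsum_le_of_sum_le (fun ν => abs_nonneg _) hfin
  have hnorm : ‖∑' ν, t ν * I ν‖ ≤ ∑' ν, ‖t ν * I ν‖ :=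
    norm_tsum_le_tsum_norm (hsum.congr fun ν => (Real.norm_eq_abs _).symm)
  simp only [Real.norm_eq_abs] at hnorm
  rw [hseries]
  exact hnorm.trans htsum

end OddSector

end Summit.Ventures.YMGap.FlowData.SU2Links
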